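import Literature.Barriers.ResolutionOfSingularities.StratumFirstInvIncreaseEdge
import Literature.AlgebraicGeometry.Hironaka2017.Proofs.S04CharAlgebra.WQExcZ
import Literature.AlgebraicGeometry.Hironaka2017.Proofs.S04CharAlgebra.WQExcWV
import HarnessLib

/-!
# Barrier supplement: `StratumFirstInvIncrease` — the «same `Inv`» step on the WHOLE exceptional `ℙ³`, IN THE KERNEL
# (charts `z, w, v`: the `ℙ² = ℙ³ ∖ E_y` left open by `StratumFirstInvIncreaseEdge.lean`)

`Literature/Barriers/ResolutionOfSingularities/StratumFirstInvIncreaseEdgeCharts.lean` — second kernel SUPPLEMENT to the catalogue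
entry `StratumFirstInvIncrease.lean` (p491195; cell res-hironaka, D-0089; drafter res-type-046). `StratumFirstInvIncreaseEdge`
(p500974) proved the edge ideal `(x̄²)` (`r = 1`, `q₁ = 2`, Eq. (34) value `(5,4,2)`) at every `K`-point of the chart `E_y ≅ 𝔸³` of
the exceptional `ℙ³` of the first point blow-up of the W-Q specimen, for the cell's typed ALGEBRAIC `℘`. This file does the same for
the remaining points `{ȳ = 0} ≅ ℙ²`, chart by chart, each in its own affine coordinates with the EXCEPTIONAL VARIABLE RE-ORDERED to
second place (the frame of `Hironaka2017/Proofs/S04CharAlgebra/WQExcGeneric`; `℘alg` of a polynomial and of its variable-renamed copy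
correspond under the renaming automorphism — here the statements are simply MADE in the renamed coordinates, which is what the link
lemmas record): `E_z ∖ E_y` (points `(0,0,0,w₀,v₀)`, `Hironaka2017/…/WQExcZ`), `E_w ∖ (E_y ∪ E_z)` (points `(0,0,0,0,v₀)`) and the
origin of `E_v` (`Hironaka2017/…/WQExcWV`). Together: EVERY `K`-point of the exceptional `ℙ³` (`K` any field of characteristic `2`).

HONEST FRAMING. H. Hironaka, *Resolution of singularities in positive characteristics*, ms. 2017 [Hironaka2017] is an UNREFEREED
MANUSCRIPT UNDER ADJUDICATION (D-0012); its definitions (`℘`, Def. 4.9 edge data, Eq. (34) `Inv`) are typed by the cell as candidates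
and only COMPUTED WITH here, on the cell's OWN specimen; nothing printed in the manuscript is asserted; nothing here is a verdict on any
printed sentence; nothing bears on resolution of singularities in characteristic `p`. AI proof, weaker than expert review.
-/

noncomputable section

namespace Literature.Barriers.ResolutionOfSingularities

open MvPolynomial Literature.AlgebraicGeometry.Hironaka2017.S04CharAlgebra

universe u

namespace StratumFirstEdge

variable (K : Type u) [Field K]

/-- **Link, `z`-chart**: re-ordering the variables to `(x, z, y, w, v)`, the parent entry's `z`-chart of the blow-up applied to `fW`
is `X₁² · fOf(H_z)` with `WQExc.Hz K 0 0` (exceptional variable `z` in second place). [claim: Hironaka2017, status: under-review]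
[cite: Hironaka2017, Def. 4.9 p.20 l.31–35 · Eq. (34) p.24 l.29–31 (unrefereed manuscript under adjudication — kernel fact about the cell's own specimen, nothing of the manuscript asserted)] -/
theorem chart_z_fW : rename ![(0 : Fin 5), 2, 1, 3, 4] (StratumFirst.chart K (1 : Fin 4) Literature.AlgebraicGeometry.Hironaka2017.WQWitness.fW) =
    X 1 ^ 2 * WQExc.fOf K (WQExc.Hz K 0 0) := by
  simp only [StratumFirst.chart, Literature.AlgebraicGeometry.Hironaka2017.WQWitness.fW, WQExc.fOf, WQExc.Hz, map_add,
    map_mul, map_pow, aeval_X, rename_X, map_zero, add_zero]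
  rw [show (Fin.succ 0 : Fin 5) = 1 from rfl, show (Fin.succ 1 : Fin 5) = 2 from rfl, show (Fin.succ 2 : Fin 5) = 3 from rfl,
    show (Fin.succ 3 : Fin 5) = 4 from rfl]
  simp only [Fin.isValue, Fin.reduceEq, if_true, if_false, map_mul, rename_X, Matrix.cons_val_zero, Matrix.cons_val_one,
    Matrix.cons_val]
  ring

/-- `f_ξ` on `E_z`: translating `fOf(H_z(0,0))` by `(w₀, v₀)` gives `fOf(Hz w₀ v₀)` (frame `(x, z, y, w, v)`).
[claim: Hironaka2017, status: under-review]
[cite: Hironaka2017, Def. 4.9 p.20 l.31–35 (unrefereed manuscript under adjudication — kernel fact about the cell's own specimen, nothing asserted)] -/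
theorem translate_fz (w₀ v₀ : K) :
    aeval ![X 0, X 1, X 2, X 3 + C w₀, X 4 + C v₀] (WQExc.fOf K (WQExc.Hz K 0 0)) = WQExc.fOf K (WQExc.Hz K w₀ v₀) := by
  simp only [WQExc.fOf, WQExc.Hz, map_add, map_mul, map_pow, aeval_X, rename_X, rename_C, map_zero, add_zero]
  rw [show (Fin.succ 0 : Fin 5) = 1 from rfl, show (Fin.succ 1 : Fin 5) = 2 from rfl, show (Fin.succ 2 : Fin 5) = 3 from rfl,
    show (Fin.succ 3 : Fin 5) = 4 from rfl]
  simp only [Fin.isValue, Matrix.cons_val_zero, Matrix.cons_val_one, Matrix.cons_val]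

/-- **Link, `w`-chart**: re-ordering to `(x, w, y, z, v)`, the `w`-chart of `fW` is `X₁² · fOf(WQExc.Hw K 0)`.
[claim: Hironaka2017, status: under-review]
[cite: Hironaka2017, Def. 4.9 p.20 l.31–35 · Eq. (34) p.24 l.29–31 (unrefereed manuscript under adjudication — kernel fact about the cell's own specimen, nothing of the manuscript asserted)] -/
theorem chart_w_fW : rename ![(0 : Fin 5), 2, 3, 1, 4] (StratumFirst.chart K (2 : Fin 4) Literature.AlgebraicGeometry.Hironaka2017.WQWitness.fW) =
    X 1 ^ 2 * WQExc.fOf K (WQExc.Hw K 0) := by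
  simp only [StratumFirst.chart, Literature.AlgebraicGeometry.Hironaka2017.WQWitness.fW, WQExc.fOf, WQExc.Hw, map_add,
    map_mul, map_pow, aeval_X, rename_X, map_zero, add_zero]
  rw [show (Fin.succ 0 : Fin 5) = 1 from rfl, show (Fin.succ 1 : Fin 5) = 2 from rfl, show (Fin.succ 2 : Fin 5) = 3 from rfl,
    show (Fin.succ 3 : Fin 5) = 4 from rfl]
  simp only [Fin.isValue, Fin.reduceEq, if_true, if_false, map_mul, rename_X, Matrix.cons_val_zero, Matrix.cons_val_one,
    Matrix.cons_val]
  ring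

/-- `f_ξ` on `E_w`: translating `fOf(H_w(0))` by `v₀` gives `fOf(Hw v₀)` (frame `(x, w, y, z, v)`). [claim: Hironaka2017, status: under-review]
[cite: Hironaka2017, Def. 4.9 p.20 l.31–35 (unrefereed manuscript under adjudication — kernel fact about the cell's own specimen, nothing asserted)] -/
theorem translate_fw (v₀ : K) :
    aeval ![X 0, X 1, X 2, X 3, X 4 + C v₀] (WQExc.fOf K (WQExc.Hw K 0)) = WQExc.fOf K (WQExc.Hw K v₀) := by
  simp only [WQExc.fOf, WQExc.Hw, map_add, map_mul, map_pow, aeval_X, rename_X, rename_C, map_zero, add_zero]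
  rw [show (Fin.succ 0 : Fin 5) = 1 from rfl, show (Fin.succ 1 : Fin 5) = 2 from rfl, show (Fin.succ 2 : Fin 5) = 3 from rfl,
    show (Fin.succ 3 : Fin 5) = 4 from rfl]
  simp only [Fin.isValue, Matrix.cons_val_zero, Matrix.cons_val_one, Matrix.cons_val]

/-- **Link, `v`-chart**: re-ordering to `(x, v, y, z, w)`, the `v`-chart of `fW` is `X₁² · fOf(WQExc.Hv K)`.
[claim: Hironaka2017, status: under-review]
[cite: Hironaka2017, Def. 4.9 p.20 l.31–35 · Eq. (34) p.24 l.29–31 (unrefereed manuscript under adjudication — kernel fact about the cell's own specimen, nothing of the manuscript asserted)] -/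
theorem chart_v_fW : rename ![(0 : Fin 5), 2, 3, 4, 1] (StratumFirst.chart K (3 : Fin 4) Literature.AlgebraicGeometry.Hironaka2017.WQWitness.fW) =
    X 1 ^ 2 * WQExc.fOf K (WQExc.Hv K) := by
  simp only [StratumFirst.chart, Literature.AlgebraicGeometry.Hironaka2017.WQWitness.fW, WQExc.fOf, WQExc.Hv, map_add,
    map_mul, map_pow, aeval_X, rename_X]
  rw [show (Fin.succ 0 : Fin 5) = 1 from rfl, show (Fin.succ 1 : Fin 5) = 2 from rfl, show (Fin.succ 2 : Fin 5) = 3 from rfl,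
    show (Fin.succ 3 : Fin 5) = 4 from rfl]
  simp only [Fin.isValue, Fin.reduceEq, if_true, if_false, map_mul, rename_X, Matrix.cons_val_zero, Matrix.cons_val_one,
    Matrix.cons_val]
  ring

end StratumFirstEdge

open StratumFirstEdge in
/-- **`StratumFirstInvIncreaseEdgeCharts` — KERNEL SUPPLEMENT #2 to `StratumFirstInvIncrease`: the «same `Inv`» step on
`ℙ³ ∖ E_y`, hence (with `StratumFirstInvIncreaseEdge`) on EVERY point of the exceptional `ℙ³`, for the ALGEBRAIC `℘`.**

For every field `K` of characteristic `2`, with `℘alg(E_H, a)` the degree-`a` piece of the cell's typed algebraic characteristic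
algebra (`S04CharAlgebra.pAlgebraicRing`, p.17 l.8–11) of `E_H = ((x² + y⁵H), 2)` in the frame of `WQExcGeneric` (`WQExc.POf`), and
`𝔪` the maximal ideal of the origin:
* (`z`-chart; every `(w₀, v₀) ∈ K²`, i.e. every `K`-point `(0,0,0,w₀,v₀)` of `E_z ∖ E_y`, exponent `fOf(Hz w₀ v₀)` = the chart
  transform re-centred there by `chart_z_fW` / `translate_fz`): `℘alg ⊆ 𝔪^a`; `x̄² ∣` every degree-`a` initial form (`a ≥ 1`);
  `℘alg(·,1) ⊆ 𝔪²`; lift identity `fOf ∈ ℘alg(·,2)`, `fOf − x² ∈ 𝔪⁵`;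
* (`w`-chart; every `v₀ ∈ K`, the points `(0,0,0,0,v₀)` of `E_w ∖ (E_y ∪ E_z)`, `chart_w_fW` / `translate_fw`): the same;
* (`v`-chart; the origin of `E_v` = the last point `(0:0:0:1)` of `ℙ³`, `chart_v_fW`): the same.
Hence at EVERY `K`-point of the exceptional `ℙ³` the edge ideal of `℘alg(E′)` is `(x̄²)` — one pure generator of degree `q₁ = 2`,
`r = 1`, Eq. (34) value `(5, 4, 2)` (Rem. 4.7 / Def. 4.9 p.20, Def. 4.11 p.21, Eq. (34) p.24; the cell's reading
`hup + lift ⇒ exists_isEdgeData_pure`): the parent entry's hand step (K3.5 §6) «`Inv` stays `(5,4,2)` on the whole exceptional `ℙ³`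
after the first point blow-up» is KERNEL for the algebraic `℘`, chart by chart. NOT covered (unchanged from supplement #1): the later
steps of K3.5's `γ`-tower; the passage algebraic `℘` ↔ geometric `℘` ([23] / U17_4) and to stalks; the glueing of the charts as a
statement about `Proj`; anything about `Σ_max` of `SigmaMaxContainsFullEdimCurve`. Nothing here is a claim about resolution of
singularities in characteristic `p`, nor a verdict on any printed sentence (D-0012/D-0089). [claim: Hironaka2017, status: under-review]
[cite: Hironaka2017, Rem. 4.7 / Def. 4.9 p.20 l.13–35 · Def. 4.11 p.21 · Eq. (34) p.24 l.29–31 · §4 p.17 l.8–11 (unrefereed manuscript under adjudication — kernel computation of OUR typed algebraic ℘ at the cell's specimen, nothing of the manuscript asserted)]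

BARRIER (D-0021) — ADDENDUM #2 to `StratumFirstInvIncrease` (same entry; completes addendum #1 to the whole exceptional `ℙ³`):
- technique_class: stratum-first top-locus-first bare-invariant no-boundary-datum intrinsic-stratification initial-form-type edge-data characteristic-algebra exceptional-divisor positive-characteristic
- blocks: as the parent entry and addendum #1; sharpened: the manuscript-style edge datum (Def. 4.9 / Eq. (34), computed for the typed ALGEBRAIC `℘`) equals `(5,4,2)` at EVERY `K`-point of the exceptional `ℙ³` of the first point blow-up of the W-Q specimen — the bare-`Inv` top stratum of the transform contains the whole `3`-dimensional exceptional `ℙ³ ∩ {x̄ = 0}` born from a point centre [claim: Hironaka2017, status: under-review].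
- because: as addendum #1 (square-root arc through the generic direction; arc weight bound for the integral closure; two coefficient extractions), plus the `j = 3` class on `E_z` (`(H_z)_3 = w₀⁵(z̄v̄² + z̄²ȳ)`, `σ₃ ∉ Frac K[z,y,w,v]` since `w₀⁵z⁶(v² + zy)` is no square) and the degree-`4` classes `z̄³ȳ` (`E_z`, `w₀ = v₀ = 0`) and `w̄z̄v̄²` (`E_w`, `v₀ = 0`), and `(H_v)_1 = w̄` with `v⁵w` no square at the last point (`WQExc.hom_G_one_eq_zero_z/_w/_v`).
- evasions_known: as the parent entry; nothing new.
- scope_caveats: (a) PROVED: parent scope (b)'s hand step for ALL `K`-points of the exceptional `ℙ³`, every field `K` of characteristic `2`, algebraic `℘`, each chart in its own re-ordered affine coordinates (link lemmas `chart_z_fW`, `chart_w_fW`, `chart_v_fW`, translations `translate_fz`, `translate_fw`); (b) NOT covered: see the list above; (c) nothing here bears on the EXISTENCE of resolutions in characteristic `p`.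
- status: established (kernel-checked: every `K`-point of the exceptional `ℙ³`, characteristic `2`, algebraic `℘`) -/
theorem StratumFirstInvIncreaseEdgeCharts :
    ∀ (K : Type u) [Field K] [CharP K 2],
      (∀ w₀ v₀ : K,
        (∀ a : ℕ, WQExc.POf K (WQExc.Hz K w₀ v₀) a ≤ MvPolynomial.idealOfVars (Fin 5) K ^ a) ∧
        (∀ a : ℕ, 1 ≤ a → ∀ g ∈ WQExc.POf K (WQExc.Hz K w₀ v₀) a,
            (X 0 : MvPolynomial (Fin 5) K) ^ 2 ∣ MvPolynomial.homogeneousComponent a g) ∧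
        WQExc.POf K (WQExc.Hz K w₀ v₀) 1 ≤ MvPolynomial.idealOfVars (Fin 5) K ^ 2 ∧
        WQExc.fOf K (WQExc.Hz K w₀ v₀) ∈ WQExc.POf K (WQExc.Hz K w₀ v₀) 2 ∧
        WQExc.fOf K (WQExc.Hz K w₀ v₀) - X 0 ^ 2 ∈ MvPolynomial.idealOfVars (Fin 5) K ^ 5) ∧
      (∀ v₀ : K,
        (∀ a : ℕ, WQExc.POf K (WQExc.Hw K v₀) a ≤ MvPolynomial.idealOfVars (Fin 5) K ^ a) ∧
        (∀ a : ℕ, 1 ≤ a → ∀ g ∈ WQExc.POf K (WQExc.Hw K v₀) a,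
            (X 0 : MvPolynomial (Fin 5) K) ^ 2 ∣ MvPolynomial.homogeneousComponent a g) ∧
        WQExc.POf K (WQExc.Hw K v₀) 1 ≤ MvPolynomial.idealOfVars (Fin 5) K ^ 2 ∧
        WQExc.fOf K (WQExc.Hw K v₀) ∈ WQExc.POf K (WQExc.Hw K v₀) 2 ∧
        WQExc.fOf K (WQExc.Hw K v₀) - X 0 ^ 2 ∈ MvPolynomial.idealOfVars (Fin 5) K ^ 5) ∧
      ((∀ a : ℕ, WQExc.POf K (WQExc.Hv K) a ≤ MvPolynomial.idealOfVars (Fin 5) K ^ a) ∧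
        (∀ a : ℕ, 1 ≤ a → ∀ g ∈ WQExc.POf K (WQExc.Hv K) a,
            (X 0 : MvPolynomial (Fin 5) K) ^ 2 ∣ MvPolynomial.homogeneousComponent a g) ∧
        WQExc.POf K (WQExc.Hv K) 1 ≤ MvPolynomial.idealOfVars (Fin 5) K ^ 2 ∧
        WQExc.fOf K (WQExc.Hv K) ∈ WQExc.POf K (WQExc.Hv K) 2 ∧
        WQExc.fOf K (WQExc.Hv K) - X 0 ^ 2 ∈ MvPolynomial.idealOfVars (Fin 5) K ^ 5) := by
  intro K _ _
  refine ⟨fun w₀ v₀ => ⟨WQExc.POf_le_pow K _, fun _ ha _ hg => WQExc.X_sq_dvd_initialForm_z K w₀ v₀ ha hg,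
      WQExc.P_one_le_sq_z K w₀ v₀, WQExc.fOf_mem_POf_two K _, WQExc.fOf_sub_sq_mem K _⟩,
    fun v₀ => ⟨WQExc.POf_le_pow K _, fun _ ha _ hg => WQExc.X_sq_dvd_initialForm_w K v₀ ha hg,
      WQExc.P_one_le_sq_w K v₀, WQExc.fOf_mem_POf_two K _, WQExc.fOf_sub_sq_mem K _⟩,
    ⟨WQExc.POf_le_pow K _, fun _ ha _ hg => WQExc.X_sq_dvd_initialForm_v K ha hg,
      WQExc.P_one_le_sq_v K, WQExc.fOf_mem_POf_two K _, WQExc.fOf_sub_sq_mem K _⟩⟩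

end Literature.Barriers.ResolutionOfSingularities

end
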